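import Mathlib.RingTheory.Length
import Mathlib.RingTheory.OrderOfVanishing.Basic
import Mathlib.LinearAlgebra.Dimension.Localization
import Mathlib.LinearAlgebra.Dimension.Torsion.Finite
import Mathlib.LinearAlgebra.Quotient.Pi
import HarnessLib

/-!
# `ℓ_A(M ⧸ aM) = rank(M) · ord_A(a)` for a torsion-free module over a one-dimensional domain

Fulton, *Intersection Theory*, App. A.3, Lemma A.3: for a one-dimensional (Noetherian) domain
`A` with fraction field `K`, a finitely generated `A`-module `M` and an endomorphism `φ` of `M`
with `det(φ_K) ≠ 0`, the Herbrand quotient `e_A(φ, M) = ℓ_A(Coker φ) - ℓ_A(Ker φ)` equals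
`ord_A(det φ_K)`, where `ord_A(a) = ℓ_A(A ⧸ aA)` (Def. A.3; Mathlib `Ring.ord`).  This file proves
the case used in Chapter 1 and Chapter 10 of Fulton (finite push-forward of divisors and of fibres
of families: `f_*[div r] = [div N(r)]`, `f_*[W_t] = deg(W/W') [W'_t]`), namely `φ =`
multiplication by a nonzero `a ∈ A` on a **torsion-free** `M`: then `Ker φ = 0`,
`det(φ_K) = aⁿ` with `n = rank M = dim_K (M ⊗ K)`, and Lemma A.3 reads

`ℓ_A(M ⧸ aM) = n · ord_A(a)`
(`Literature.RingTheory.Length.length_quot_smul_top_eq_finrank_mul_ord`).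

The proof given here is direct (no determinants): choose a free submodule `F ≅ Aⁿ ⊆ M` with
`M ⧸ F` torsion — a finitely generated module killed by a non-zero-divisor `c`, hence of finite
length over the at most one-dimensional Noetherian ring `A` (it is a quotient of `(A ⧸ cA)ᵏ`,
and `A ⧸ cA` has finite length, Mathlib `isFiniteLength_quotient_span_singleton`).  Since `x ↦ a x`
is injective, `aM ⧸ aF ≅ M ⧸ F`, so computing `ℓ_A(M ⧸ aF)` through `aF ⊆ aM ⊆ M` and through
`aF ⊆ F ⊆ M` gives `ℓ(M ⧸ aM) + ℓ(M ⧸ F) = ℓ(M ⧸ F) + ℓ(F ⧸ aF)` with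
`ℓ(F ⧸ aF) = ℓ((A ⧸ aA)ⁿ) = n · ord_A(a)`; cancel the finite `ℓ(M ⧸ F)`.

## Main results

* `Literature.RingTheory.Length.length_quotient_eq_add_of_le`: `ℓ(M/U) = ℓ(M/V) + ℓ(V/U)` for
  `U ≤ V`.
* `Literature.RingTheory.Length.length_pi_quot_smul_top`: `ℓ_A(Aⁿ ⧸ aAⁿ) = n · ord_A(a)`.
* `Literature.RingTheory.Length.length_ne_top_of_smul_eq_zero`: a finitely generated module
  killed by a non-zero-divisor has finite length (`A` Noetherian of dimension `≤ 1`).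
* `Literature.RingTheory.Length.length_quot_smul_top_eq_finrank_mul_ord`: Fulton Lemma A.3 for
  `φ = a`, `M` torsion-free.

Mathlib has `Module.length` with additivity, `Ring.ord`, `isFiniteLength_quotient_span_singleton`,
rank–nullity over domains (`HasRankNullity`), `Module.finrank_eq_zero_iff_isTorsion`,
`Submodule.annihilator_top_inter_nonZeroDivisors`, `Submodule.quotientPi`; it does not have
Herbrand quotients or Lemma A.3 (searched `Module.length` in `RingTheory/`: `Length`,
`LocalRing/Length`, `OrderOfVanishing`, `RamificationInertia` only).

## References

* [Fulton1998] W. Fulton, *Intersection Theory*, 2nd ed., Springer (1998), Appendix A: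
  Def. A.3 and Lemma A.3 (also Lemmas A.1.1, A.2.1, A.2.5, Example A.2.3).
-/

universe u v

open Module Submodule Pointwise

namespace Literature.RingTheory.Length

variable {A : Type u} [CommRing A] {M : Type v} [AddCommGroup M] [Module A M]

/-! ### Lengths of nested quotients -/

/-- For submodules `U ≤ V` of `M`: `ℓ(M/U) = ℓ(M/V) + ℓ(V/U)`, with `V/U` realised as the image
`V.map U.mkQ ≤ M/U` (third isomorphism theorem and additivity of length). [folklore] -/
lemma length_quotient_eq_add_of_le {U V : Submodule A M} (h : U ≤ V) :
    Module.length A (M ⧸ U) =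
      Module.length A (M ⧸ V) + Module.length A ↥(V.map U.mkQ) := by
  rw [Module.length_eq_add_of_exact (V.map U.mkQ).subtype (V.map U.mkQ).mkQ
    (Submodule.injective_subtype _) (Submodule.mkQ_surjective _)
    (LinearMap.exact_subtype_mkQ _),
    (Submodule.quotientQuotientEquivQuotient U V h).length_eq, add_comm]

/-! ### Multiplication by a scalar on a torsion-free module -/

section TorsionFree

variable [IsDomain A] [IsTorsionFree A M] {a : A}

/-- On a torsion-free module over a domain and for `a ≠ 0`, multiplication by `a` identifies
`M ⧸ F` with `aM ⧸ aF`, the latter realised as the image of `aM = range (a •)` in `M ⧸ aF`.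
[folklore] -/
lemma nonempty_linearEquiv_map_range_lsmul (ha : a ≠ 0) (F : Submodule A M) :
    Nonempty ((M ⧸ F) ≃ₗ[A]
      ↥((LinearMap.range (LinearMap.lsmul A M a)).map
        ((F.map (LinearMap.lsmul A M a)).mkQ))) := by
  set μ := LinearMap.lsmul A M a with hμ
  have hinj : Function.Injective μ := fun x y hxy ↦ smul_right_injective M ha hxy
  -- the map `M → M ⧸ μ F`, `x ↦ [a • x]`, lands in the image of `range μ`
  let φ : M →ₗ[A] M ⧸ F.map μ := (F.map μ).mkQ ∘ₗ μ
  have hφ_range : LinearMap.range φ = (LinearMap.range μ).map (F.map μ).mkQ := by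
    rw [LinearMap.range_comp]
  have hφ_ker : LinearMap.ker φ = F := by
    ext x
    simp only [φ, LinearMap.mem_ker, LinearMap.coe_comp, Function.comp_apply, Submodule.mkQ_apply,
      Submodule.Quotient.mk_eq_zero, Submodule.mem_map]
    constructor
    · rintro ⟨y, hy, hyx⟩
      rwa [← hinj hyx]
    · exact fun hx ↦ ⟨x, hx, rfl⟩
  exact ⟨Submodule.quotEquivOfEq F (LinearMap.ker φ) hφ_ker.symm ≪≫ₗ φ.quotKerEquivRange
    ≪≫ₗ LinearEquiv.ofEq _ _ hφ_range⟩

end TorsionFree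

/-! ### `Aⁿ ⧸ a Aⁿ ≅ (A ⧸ aA)ⁿ` and its length -/

section Pi

variable (a : A) (n : ℕ)

/-- `a • Aⁿ` is the product submodule `∏ (a)`. [folklore] -/
lemma smul_top_pi_eq :
    (a • (⊤ : Submodule A (Fin n → A))) = Submodule.pi Set.univ (fun _ ↦ Ideal.span {a}) := by
  ext c
  simp only [Submodule.mem_smul_pointwise_iff_exists, Submodule.mem_top, true_and,
    Submodule.mem_pi, Set.mem_univ, forall_const, Ideal.mem_span_singleton']
  constructor
  · rintro ⟨d, rfl⟩ i
    exact ⟨d i, by simp [mul_comm]⟩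
  · intro h
    choose d hd using h
    exact ⟨d, funext fun i ↦ by simp [← hd i, mul_comm]⟩

/-- `Aⁿ ⧸ a Aⁿ ≃ (A ⧸ aA)ⁿ` (Mathlib `Submodule.quotientPi`). [folklore] -/
lemma nonempty_piQuotSMulTop_linearEquiv :
    Nonempty (((Fin n → A) ⧸ (a • (⊤ : Submodule A (Fin n → A)))) ≃ₗ[A]
      (Fin n → A ⧸ Ideal.span {a})) :=
  ⟨Submodule.quotEquivOfEq _ _ (smul_top_pi_eq a n) ≪≫ₗ Submodule.quotientPi _⟩

/-- `ℓ_A((A ⧸ aA)ⁿ) = n · ord_A(a)`. [folklore] -/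
lemma length_pi_quotient_span_singleton :
    Module.length A (Fin n → A ⧸ Ideal.span {a}) = n * Ring.ord A a := by
  rw [Module.length_pi_of_fintype, Finset.sum_const, Finset.card_univ, Fintype.card_fin,
    nsmul_eq_mul]
  rfl

/-- `ℓ_A(Aⁿ ⧸ a Aⁿ) = n · ord_A(a)`. [folklore] -/
lemma length_pi_quot_smul_top :
    Module.length A ((Fin n → A) ⧸ (a • (⊤ : Submodule A (Fin n → A)))) =
      n * Ring.ord A a := by
  obtain ⟨e⟩ := nonempty_piQuotSMulTop_linearEquiv a n
  rw [e.length_eq, length_pi_quotient_span_singleton]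

end Pi

/-! ### Finitely generated modules killed by a non-zero-divisor have finite length -/

section Killed

variable [IsNoetherianRing A] [Ring.KrullDimLE 1 A]

/-- Over a Noetherian ring of dimension `≤ 1`, a finitely generated module annihilated by a
non-zero-divisor `c` has finite length (it is a quotient of `(A ⧸ cA)ᵏ`, and `A ⧸ cA` has finite
length, Mathlib `isFiniteLength_quotient_span_singleton`). [folklore] -/
lemma length_ne_top_of_smul_eq_zero {Q : Type*} [AddCommGroup Q] [Module A Q] [Module.Finite A Q]
    {c : A} (hc : c ∈ nonZeroDivisors A) (hcQ : ∀ q : Q, c • q = 0) :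
    Module.length A Q ≠ ⊤ := by
  obtain ⟨k, f, hf⟩ := Module.Finite.exists_fin' A Q
  -- `f` kills `c • ⊤`
  have hle : (c • (⊤ : Submodule A (Fin k → A))) ≤ LinearMap.ker f := by
    intro x hx
    obtain ⟨y, -, rfl⟩ := (Submodule.mem_smul_pointwise_iff_exists _ _ _).mp hx
    rw [LinearMap.mem_ker, LinearMap.map_smul_of_tower]
    exact hcQ _
  have hsurj : Function.Surjective ((c • (⊤ : Submodule A (Fin k → A))).liftQ f hle) := by
    intro q
    obtain ⟨x, rfl⟩ := hf q
    exact ⟨Submodule.Quotient.mk x, rfl⟩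
  have hfin :
      Module.length A ((Fin k → A) ⧸ (c • (⊤ : Submodule A (Fin k → A)))) ≠ ⊤ := by
    rw [length_pi_quot_smul_top]
    exact WithTop.mul_ne_top (ENat.coe_ne_top k) (Ring.ord_ne_top hc)
  exact ne_top_of_le_ne_top hfin (Module.length_le_of_surjective _ hsurj)

end Killed

/-! ### The main theorem -/

section Main

variable [IsDomain A] [IsNoetherianRing A] [Ring.KrullDimLE 1 A] [IsTorsionFree A M]
  [Module.Finite A M]

/-- **Fulton, Intersection Theory, Lemma A.3, for `φ =` multiplication by `a` on a torsion-free
module** (so that `e_A(a, M) = ℓ_A(M/aM)` and `det(φ_K) = aⁿ`, `n = rank M`;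
`ord_A(aⁿ) = n · ord_A(a)` by Lemma A.2.5): over a Noetherian domain `A` of dimension `≤ 1`, for a
finitely generated torsion-free module `M` of rank `n = dim_K (M ⊗ K)` and `0 ≠ a ∈ A`,
`ℓ_A(M ⧸ aM) = n · ℓ_A(A ⧸ aA) = n · ord_A(a)`.  (Fulton states App. A for local rings in the
applications; locality is not needed here.)  Proof: choose `F ≅ Aⁿ` free inside `M` with `M/F`
torsion, hence of finite length (it is killed by a nonzero `c`); since `x ↦ a x` is injective,
`ℓ(M/aF) = ℓ(M/aM) + ℓ(aM/aF) = ℓ(M/aM) + ℓ(M/F)` and `ℓ(M/aF) = ℓ(M/F) + ℓ(F/aF)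
= ℓ(M/F) + n · ord_A(a)`; cancel the finite `ℓ(M/F)`. [cite: Fulton1998, Lemma A.3] -/
theorem length_quot_smul_top_eq_finrank_mul_ord {a : A} (ha : a ≠ 0) :
    Module.length A (M ⧸ (a • (⊤ : Submodule A M))) = Module.finrank A M * Ring.ord A a := by
  set n := Module.finrank A M with hn
  set μ := LinearMap.lsmul A M a with hμ
  have hinj : Function.Injective μ := fun x y hxy ↦ smul_right_injective M ha hxy
  -- a free submodule `F = span (v₁, …, vₙ)` of rank `n`
  obtain ⟨v, hv⟩ := exists_linearIndependent_of_le_finrank (R := A) (M := M) hn.ge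
  set F : Submodule A M := Submodule.span A (Set.range v) with hF
  let b : Basis (Fin n) A F := Basis.span hv
  have hFrank : Module.finrank A F = n := by
    rw [Module.finrank_eq_card_basis b, Fintype.card_fin]
  -- `M ⧸ F` is torsion, hence of finite length
  have hQ : Module.length A (M ⧸ F) ≠ ⊤ := by
    have h0 : Module.finrank A (M ⧸ F) = 0 := by
      have h := Submodule.finrank_quotient_add_finrank F
      rw [hFrank, ← hn] at h
      omega
    have htors : Module.IsTorsion A (M ⧸ F) := (Module.finrank_eq_zero_iff_isTorsion).mp h0
    obtain ⟨c, hc, hc0⟩ := Submodule.annihilator_top_inter_nonZeroDivisors htors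
    refine length_ne_top_of_smul_eq_zero hc0 fun q ↦ ?_
    exact Submodule.mem_annihilator.mp hc q Submodule.mem_top
  -- `U = a F`, contained in `a M = range μ` and in `F`
  set U : Submodule A M := F.map μ with hU
  have hU₁ : U ≤ LinearMap.range μ := LinearMap.map_le_range
  have hU₂ : U ≤ F := by
    rintro _ ⟨x, hx, rfl⟩
    exact F.smul_mem a hx
  -- `ℓ(M/U) = ℓ(M/aM) + ℓ(M/F)`
  have E1 : Module.length A (M ⧸ U) =
      Module.length A (M ⧸ LinearMap.range μ) + Module.length A (M ⧸ F) := by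
    obtain ⟨e⟩ := nonempty_linearEquiv_map_range_lsmul (M := M) ha F
    rw [length_quotient_eq_add_of_le hU₁, ← e.length_eq]
  -- `ℓ(M/U) = ℓ(M/F) + n · ord a`
  have E2 : Module.length A (M ⧸ U) = Module.length A (M ⧸ F) + n * Ring.ord A a := by
    rw [length_quotient_eq_add_of_le hU₂]
    congr 1
    -- `F.map U.mkQ ≃ F ⧸ (U.comap F.subtype) = F ⧸ a F ≃ Aⁿ ⧸ a Aⁿ`
    have hcomap : U.comap F.subtype = a • (⊤ : Submodule A F) := by
      ext x
      simp only [Submodule.mem_comap, Submodule.subtype_apply, hU, Submodule.mem_map,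
        Submodule.mem_smul_pointwise_iff_exists, Submodule.mem_top, true_and]
      constructor
      · rintro ⟨y, hy, hyx⟩
        refine ⟨⟨y, hy⟩, Subtype.ext ?_⟩
        simpa [hμ] using hyx
      · rintro ⟨y, rfl⟩
        exact ⟨y, y.2, by simp [hμ]⟩
    let ψ : F →ₗ[A] M ⧸ U := U.mkQ ∘ₗ F.subtype
    have hψ_range : LinearMap.range ψ = F.map U.mkQ := by
      rw [LinearMap.range_comp, Submodule.range_subtype]
    have hψ_ker : LinearMap.ker ψ = a • (⊤ : Submodule A F) := by
      rw [LinearMap.ker_comp, Submodule.ker_mkQ, hcomap]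
    have e₁ : ↥(F.map U.mkQ) ≃ₗ[A] (F ⧸ (a • (⊤ : Submodule A F))) :=
      (LinearEquiv.ofEq _ _ hψ_range).symm ≪≫ₗ ψ.quotKerEquivRange.symm ≪≫ₗ
        Submodule.quotEquivOfEq _ _ hψ_ker
    -- transport along the basis `F ≃ Aⁿ`
    have hmap : (a • (⊤ : Submodule A F)).map (b.equivFun : F →ₗ[A] (Fin n → A)) =
        a • (⊤ : Submodule A (Fin n → A)) := by
      rw [Submodule.map_pointwise_smul, Submodule.map_top, LinearEquiv.range]
    have e₂ : (F ⧸ (a • (⊤ : Submodule A F))) ≃ₗ[A]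
        ((Fin n → A) ⧸ (a • (⊤ : Submodule A (Fin n → A)))) :=
      Submodule.Quotient.equiv _ _ b.equivFun hmap
    rw [e₁.length_eq, e₂.length_eq, length_pi_quot_smul_top]
  -- cancel the finite `ℓ(M/F)`
  have E : Module.length A (M ⧸ LinearMap.range μ) + Module.length A (M ⧸ F) =
      n * Ring.ord A a + Module.length A (M ⧸ F) := by
    rw [← E1, E2, add_comm]
  have hrange : LinearMap.range μ = a • (⊤ : Submodule A M) := by
    rw [Submodule.pointwise_smul_def, LinearMap.range_eq_map]
    rfl
  rw [← hrange]
  exact WithTop.add_right_cancel hQ E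

end Main

end Literature.RingTheory.Length
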